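import Summits.BirchSwinnertonDyer.BirchSwinnertonDyer.Theorems.AdditivePotSupersingularRankOneTowerSurjOfKato
import HarnessLib

/-!
# Rank-one kernels at an additive prime with the Heegner field of LARGE discriminant (`|d_K| > B`, Friedberg–Hoffstein), and
# their use: the potentially supersingular rows with `E(K)[p] = 0` for all imaginary quadratic `K` of large discriminant —
# which covers, besides every X4 row, the X3 rows whose `K`-rational `p`-torsion lives over finitely many quadratic fields

Prover seat `bsd-potss-kmc`, gen 20 (cell `bsd-potss`; K9 19200 `WildRankOne` / KT 19984 `TameRankOne` — their X3 = reducible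
rows, 9 376 + … S-b pairs, which the irreducible-row kernels do not reach), 2026-08-27. HONEST FRAMING: CONDITIONAL on every
displayed hypothesis; 0 definitions, 0 named facts minted, 0 `sorry`; closes nothing; BSD_p for no curve.

The Friedberg–Hoffstein fact in `ToricPublishedInputs` supplies, for every bound `B`, a Heegner field with `2`, `3` split AND
`|d_K| > B`. Regime B1 of the K1 door needs only `E(K)[p] = 0` for THAT `K`; for a curve with a rational `p`-isogeny whose kernel
character `ψ` is neither trivial nor `ω`, `E(K)[p] ≠ 0` happens for at most the two quadratic fields `ℚ(ψ)`, `ℚ(ψω)` — so a bound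
`B` exists (this finite-set statement is the ROW HYPOTHESIS `hB` below, not proved here).

* §1 `missingLowerBoundAt_of_indexLower_of_twistUpper_row_discr`, `bsdp_of_indexHalves_of_twistHalves_row_discr` — gen 20's
  row kernels with the extra binder `B < |d_K|` on every datum hypothesis.
* §2 **`bsdp_potSS_of_noTorsionLargeDiscr_of_flatIMCEq_of_twistHalves_of_facts`** `(p) (R)` — rows `R W`, `ClassO5 ∨ ClassO6`,
  `r_an = 1`, and `hB`: `∃ B, ∀ K imaginary quadratic with |d_K| > B, E(K)[p] = 0`: `BSD_p(W)` ⟸ IMC♭-eq ∧ the twist's r = 0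
  LOWER and UPPER halves (hypotheses; for X3 at the wild `3` the upper half is K9's U₀-red 19190, settled by citation) ∧ the seven
  facts ∧ Hsieh ∧ LZZ ∧ published; **`missingLowerBoundAt_potSS_of_noTorsionLargeDiscr_of_flatEisenstein_of_twistUpper_of_facts`** —
  the r = 1 LOWER half ⟸ X♭ ∧ the twist's U₀ ∧ print.

References: [FriedbergHoffstein1995] Thm. B; [JetchevSkinnerWan2017] §7.4.1, Thm. 3.3.1; [GrossZagier1986] I.(6.3), Thm. I.7.3;
[Hsieh2014] Thm A; [LiuZhangZhang2018] Thm 1.5.1/1.5.3; [Brink2007] Thm 2, Cor 1; [Serre1967GroupesPDivisibles] §5 Prop. 8.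
-/

noncomputable section

open scoped Classical

set_option linter.dupNamespace false
set_option autoImplicit false

namespace Summit.BirchSwinnertonDyer.BirchSwinnertonDyer.Theorems.UniversalToricDescentWaldspurgerFlat

open WeierstrassCurve NumberField IsDedekindDomain Field PowerSeries
  Literature.NumberTheory.EllipticCurves
  Literature.NumberTheory.EllipticCurves.ModularForms
  Literature.NumberTheory.EllipticCurves.Rank1Residual
  Literature.NumberTheory.EllipticCurves.Rank1Residual.Typed
  Literature.NumberTheory.EllipticCurves.KrizLi2019
  Literature.NumberTheory.GaloisRepresentations
  Literature.NumberTheory.GaloisCohomology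
  Summit.BirchSwinnertonDyer.Rank1Residual
  Summit.BirchSwinnertonDyer.Rank1Residual.Additive
  Summit.BirchSwinnertonDyer.Rank1Residual.X11b
  Summit.BirchSwinnertonDyer.Rank1Residual.X11b.AcSelmer
  Summit.BirchSwinnertonDyer.Rank1Residual.X11b.Halves
  Summit.BirchSwinnertonDyer.Rank1Residual.X11b.CongruenceLimit
  Summit.BirchSwinnertonDyer.BirchSwinnertonDyer.Theses.UniversalToricDescent
  Summit.BirchSwinnertonDyer.BirchSwinnertonDyer.Theorems.AdditivePotSupersingularControl

/-! ## §1 Row kernels at a Heegner field of large discriminant -/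

/-- **The r = 1 LOWER half from STEP L and the twists' r = 0 UPPER half — ROW-LOCAL, any odd additive `p`; every
hypothesis is asked only at Heegner fields with `d_K` ODD, `d_K < −4` and `|d_K| > B` for a prescribed bound `B` (the Friedberg–Hoffstein field the proof uses), so that a
consumer can transport the local class of `E` to `E^{(d_K)}` (`classO6_twist_of_heegner` needs `d_K ≡ 1 (mod 4)`).** For one
globally minimal `W` additive at the odd `p` with `r_an = 1`: IF at every Heegner datum of `W` over an imaginary quadratic
Heegner field with `d_K` odd, `d_K < −4`, `L(E^{(d_K)},1) ≠ 0`, `P` the non-torsion Heegner point,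
`IndexLowerBoundLeAt W p K P (v_p c)` holds, and every globally minimal model `Wd` of such a twist satisfies
`MissingUpperBoundAt Wd p`, THEN `MissingLowerBoundAt W p` (parity, Friedberg–Hoffstein with `2`, `3` split, Gross–Zagier
non-torsion, kmc g17's `jointLowerBoundAt_of_stepL_manin`, then `missingLowerBoundAt_of_joint_of_upper`). CONDITIONAL.
[cite: GrossZagier1986, I.(6.3) and Thm. I.7.3] [cite: JetchevSkinnerWan2017, §7.4.1 (arXiv:1512.06894 p. 30)]
[cite: FriedbergHoffstein1995, Thm. B] [cite: Miller2011LMS, Def. 1.1 (arXiv:1010.2431 p. 3)] -/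
theorem missingLowerBoundAt_of_indexLower_of_twistUpper_row_discr (p : ℕ) [Fact p.Prime] (hp2 : p ≠ 2)
    (hF : ToricPublishedInputs) (B : ℕ)
    (W : WeierstrassCurve ℚ) [W.IsElliptic] [W.IsGloballyMinimal] (haddv : Addv W p) (hr : W.analyticRank = 1)
    (hLoI : ∀ (N : ℕ) [NeZero N] (K : Type) [Field K] [NumberField K] (Dt : ModularParametrizationData W N)
      (H : HeegnerDatum N (NumberField.discr K)) (ι : K →+* ℂ) (P : (W.baseChange K).toAffine.Point),
      W.conductorNorm ℤ = N → IsImaginaryQuadratic K → SatisfiesHeegnerHypothesis N K → Odd (NumberField.discr K) →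
      NumberField.discr K < -4 → B < (NumberField.discr K).natAbs →
      (W.quadraticTwist (NumberField.discr K : ℚ)).entireLFunction 1 ≠ 0 →
      WeierstrassCurve.Affine.Point.map ι.toRatAlgHom P = heegnerPointComplex Dt H → ¬ IsOfFinAddOrder P →
      SchneiderFree.IndexLowerBoundLeAt W p K P (padicValNat p Dt.c.natAbs))
    (hTwUp : ∀ (N : ℕ) [NeZero N] (K : Type) [Field K] [NumberField K]
      (Wd : WeierstrassCurve ℚ) [Wd.IsElliptic] [Wd.IsGloballyMinimal],
      W.conductorNorm ℤ = N → IsImaginaryQuadratic K → SatisfiesHeegnerHypothesis N K → Odd (NumberField.discr K) →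
      NumberField.discr K < -4 → B < (NumberField.discr K).natAbs →
      (∃ C : VariableChange ℚ, C • W.quadraticTwist (NumberField.discr K : ℚ) = Wd) →
      (W.quadraticTwist (NumberField.discr K : ℚ)).entireLFunction 1 ≠ 0 → MissingUpperBoundAt Wd p) :
    MissingLowerBoundAt W p := by
  have hp : p.Prime := Fact.out
  obtain ⟨hGZ, hKo, hGZK, hmod, hmodP, -, hGZ73, hFH, hpar, hHP⟩ := hF
  haveI hN0 : NeZero (W.conductorNorm ℤ) := ⟨W.conductorNorm_pos_holds.ne'⟩
  have hw : W.rootNumber = -1 := by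
    rcases W.rootNumber_eq_one_or with h | h
    · exfalso
      have heven : Even W.analyticRank := (hpar W).mpr h
      rw [hr] at heven
      exact Nat.not_even_one heven
    · exact h
  obtain ⟨K, _, _, hK, hB, hHN, hH6, hLt⟩ := hFH W hw 6 (by norm_num) B
  have hodd : Odd (NumberField.discr K) := by
    have h8 := Literature.SatisfiesHeegnerHypothesis.discr_emod_eight hK.1 hH6 (by norm_num : (2 : ℕ) ∣ 6)
    rw [Int.odd_iff]; omega
  have hd4 : NumberField.discr K < -4 :=
    discr_lt_neg_four_of_three_split hK (hH6 3 Nat.prime_three (by norm_num : (3 : ℕ) ∣ 6))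
  have hwK : ¬ p ∣ Units.torsionOrder K := by
    rw [Literature.NumberTheory.QuadraticFields.Quadratic.torsionOrder_eq_two_of_discr_lt_neg_four hK.1 hd4]
    intro h
    exact hp2 ((Nat.prime_dvd_prime_iff_eq hp Nat.prime_two).mp h)
  have hpN : p ∣ W.conductorNorm ℤ :=
    (W.dvd_conductorNorm_iff_not_hasGoodReductionAtPrime p).mpr (not_good_of_addv W p haddv)
  obtain ⟨P, Dt, H, ι, hP⟩ := hHP W K hK hHN
  have hL0 : W.entireLFunction 1 = 0 := entireLFunction_one_eq_zero_of_analyticRank_eq_one hr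
  obtain ⟨-, hderiv⟩ := leadingLCoeff_eq_deriv_of_analyticRank_eq_one hr
  have hLK : LDerivEK W K ≠ 0 := by
    rw [lDerivEK_eq_deriv_mul W K hmod hL0]; exact mul_ne_zero hderiv hLt
  have hnt : ¬ IsOfFinAddOrder P :=
    (lDerivEK_ne_zero_iff_not_isOfFinAddOrder W (W.conductorNorm ℤ) K (hGZ _ W K) hK hHN
      ⟨Dt, H, ι, hP⟩).mp hLK
  have hlo : SchneiderFree.IndexLowerBoundLeAt W p K P (padicValNat p Dt.c.natAbs) :=
    hLoI (W.conductorNorm ℤ) K Dt H ι P rfl hK hHN hodd hd4 hB hLt hP hnt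
  have hD0 : (NumberField.discr K : ℚ) ≠ 0 := by exact_mod_cast NumberField.discr_ne_zero K
  haveI : (W.quadraticTwist (NumberField.discr K : ℚ)).IsElliptic := W.isElliptic_quadraticTwist hD0
  obtain ⟨Cd, hCd⟩ := hasGlobalMinimalModel_rat_holds (W.quadraticTwist (NumberField.discr K : ℚ))
  haveI : (Cd • W.quadraticTwist (NumberField.discr K : ℚ)).IsGloballyMinimal := hCd
  have hdup : MissingUpperBoundAt (Cd • W.quadraticTwist (NumberField.discr K : ℚ)) p :=
    hTwUp (W.conductorNorm ℤ) K (Cd • W.quadraticTwist (NumberField.discr K : ℚ)) rfl hK hHN hodd hd4 hB ⟨Cd, rfl⟩ hLt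
  exact missingLowerBoundAt_of_joint_of_upper
    (SchneiderFree.Exact.jointLowerBoundAt_of_stepL_manin hGZ hKo hGZK hmod hGZ73 W p (W.conductorNorm ℤ) K Dt H ι P
      (Cd • W.quadraticTwist (NumberField.discr K : ℚ)) hr rfl hpN hK hodd hwK hHN hLt hP ⟨Cd, rfl⟩ hp2 hlo) hdup

/-- **`BSD_p` in analytic rank one at ANY odd additive prime from the two INDEX SOCKETS and the two HALVES of the
rank-zero twist — ROW-LOCAL, every hypothesis asked only at Heegner fields with `d_K` ODD, `d_K < −4`, `|d_K| > B`** (the halves form of `bsdp_of_indexHalves_of_twist_row`: the partner enters through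
`MissingLowerBoundAt Wd p` and `MissingUpperBoundAt Wd p` separately, so that a planner can feed the r = 0 lower half
(research) and the r = 0 upper half (often print: Kato's bound) from different sources). Terminal step kmc g17's
`SchneiderFree.Exact.bsdp_of_exactIndexManin_of_partner_halves`. CONDITIONAL; closes nothing.
[cite: GrossZagier1986, I.(6.3) and Thm. I.7.3] [cite: JetchevSkinnerWan2017, §7.4.1 (arXiv:1512.06894 p. 30)]
[cite: FriedbergHoffstein1995, Thm. B] -/
theorem bsdp_of_indexHalves_of_twistHalves_row_discr (p : ℕ) [Fact p.Prime] (hp2 : p ≠ 2) (hF : ToricPublishedInputs)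
    (B : ℕ)
    (W : WeierstrassCurve ℚ) [W.IsElliptic] [W.IsGloballyMinimal] (haddv : Addv W p) (hr : W.analyticRank = 1)
    (hLoI : ∀ (N : ℕ) [NeZero N] (K : Type) [Field K] [NumberField K] (Dt : ModularParametrizationData W N)
      (H : HeegnerDatum N (NumberField.discr K)) (ι : K →+* ℂ) (P : (W.baseChange K).toAffine.Point),
      W.conductorNorm ℤ = N → IsImaginaryQuadratic K → SatisfiesHeegnerHypothesis N K → Odd (NumberField.discr K) →
      NumberField.discr K < -4 → B < (NumberField.discr K).natAbs →
      (W.quadraticTwist (NumberField.discr K : ℚ)).entireLFunction 1 ≠ 0 →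
      WeierstrassCurve.Affine.Point.map ι.toRatAlgHom P = heegnerPointComplex Dt H → ¬ IsOfFinAddOrder P →
      SchneiderFree.IndexLowerBoundLeAt W p K P (padicValNat p Dt.c.natAbs))
    (hUpI : ∀ (N : ℕ) [NeZero N] (K : Type) [Field K] [NumberField K] (Dt : ModularParametrizationData W N)
      (H : HeegnerDatum N (NumberField.discr K)) (ι : K →+* ℂ) (P : (W.baseChange K).toAffine.Point),
      W.conductorNorm ℤ = N → IsImaginaryQuadratic K → SatisfiesHeegnerHypothesis N K → Odd (NumberField.discr K) →
      NumberField.discr K < -4 → B < (NumberField.discr K).natAbs →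
      (W.quadraticTwist (NumberField.discr K : ℚ)).entireLFunction 1 ≠ 0 →
      WeierstrassCurve.Affine.Point.map ι.toRatAlgHom P = heegnerPointComplex Dt H → ¬ IsOfFinAddOrder P →
      SchneiderFree.Upper.IndexUpperBoundLeAt W p K P (padicValNat p Dt.c.natAbs))
    (hTwLo : ∀ (N : ℕ) [NeZero N] (K : Type) [Field K] [NumberField K]
      (Wd : WeierstrassCurve ℚ) [Wd.IsElliptic] [Wd.IsGloballyMinimal],
      W.conductorNorm ℤ = N → IsImaginaryQuadratic K → SatisfiesHeegnerHypothesis N K → Odd (NumberField.discr K) →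
      NumberField.discr K < -4 → B < (NumberField.discr K).natAbs →
      (∃ C : VariableChange ℚ, C • W.quadraticTwist (NumberField.discr K : ℚ) = Wd) →
      (W.quadraticTwist (NumberField.discr K : ℚ)).entireLFunction 1 ≠ 0 → MissingLowerBoundAt Wd p)
    (hTwUp : ∀ (N : ℕ) [NeZero N] (K : Type) [Field K] [NumberField K]
      (Wd : WeierstrassCurve ℚ) [Wd.IsElliptic] [Wd.IsGloballyMinimal],
      W.conductorNorm ℤ = N → IsImaginaryQuadratic K → SatisfiesHeegnerHypothesis N K → Odd (NumberField.discr K) →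
      NumberField.discr K < -4 → B < (NumberField.discr K).natAbs →
      (∃ C : VariableChange ℚ, C • W.quadraticTwist (NumberField.discr K : ℚ) = Wd) →
      (W.quadraticTwist (NumberField.discr K : ℚ)).entireLFunction 1 ≠ 0 → MissingUpperBoundAt Wd p) :
    BSDp W p := by
  have hp : p.Prime := Fact.out
  obtain ⟨hGZ, hKo, hGZK, hmod, hmodP, -, hGZ73, hFH, hpar, hHP⟩ := hF
  haveI hN0 : NeZero (W.conductorNorm ℤ) := ⟨W.conductorNorm_pos_holds.ne'⟩
  have hw : W.rootNumber = -1 := by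
    rcases W.rootNumber_eq_one_or with h | h
    · exfalso
      have heven : Even W.analyticRank := (hpar W).mpr h
      rw [hr] at heven
      exact Nat.not_even_one heven
    · exact h
  obtain ⟨K, _, _, hK, hB, hHN, hH6, hLt⟩ := hFH W hw 6 (by norm_num) B
  have hodd : Odd (NumberField.discr K) := by
    have h8 := Literature.SatisfiesHeegnerHypothesis.discr_emod_eight hK.1 hH6 (by norm_num : (2 : ℕ) ∣ 6)
    rw [Int.odd_iff]; omega
  have hd4 : NumberField.discr K < -4 :=
    discr_lt_neg_four_of_three_split hK (hH6 3 Nat.prime_three (by norm_num : (3 : ℕ) ∣ 6))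
  have hwK : ¬ p ∣ Units.torsionOrder K := by
    rw [Literature.NumberTheory.QuadraticFields.Quadratic.torsionOrder_eq_two_of_discr_lt_neg_four hK.1 hd4]
    intro h
    exact hp2 ((Nat.prime_dvd_prime_iff_eq hp Nat.prime_two).mp h)
  have hpN : p ∣ W.conductorNorm ℤ :=
    (W.dvd_conductorNorm_iff_not_hasGoodReductionAtPrime p).mpr (not_good_of_addv W p haddv)
  obtain ⟨P, Dt, H, ι, hP⟩ := hHP W K hK hHN
  have hL0 : W.entireLFunction 1 = 0 := entireLFunction_one_eq_zero_of_analyticRank_eq_one hr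
  obtain ⟨-, hderiv⟩ := leadingLCoeff_eq_deriv_of_analyticRank_eq_one hr
  have hLK : LDerivEK W K ≠ 0 := by
    rw [lDerivEK_eq_deriv_mul W K hmod hL0]; exact mul_ne_zero hderiv hLt
  have hnt : ¬ IsOfFinAddOrder P :=
    (lDerivEK_ne_zero_iff_not_isOfFinAddOrder W (W.conductorNorm ℤ) K (hGZ _ W K) hK hHN
      ⟨Dt, H, ι, hP⟩).mp hLK
  have hlo : SchneiderFree.IndexLowerBoundLeAt W p K P (padicValNat p Dt.c.natAbs) :=
    hLoI (W.conductorNorm ℤ) K Dt H ι P rfl hK hHN hodd hd4 hB hLt hP hnt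
  have hupI : SchneiderFree.Upper.IndexUpperBoundLeAt W p K P (padicValNat p Dt.c.natAbs) :=
    hUpI (W.conductorNorm ℤ) K Dt H ι P rfl hK hHN hodd hd4 hB hLt hP hnt
  have hD0 : (NumberField.discr K : ℚ) ≠ 0 := by exact_mod_cast NumberField.discr_ne_zero K
  haveI : (W.quadraticTwist (NumberField.discr K : ℚ)).IsElliptic := W.isElliptic_quadraticTwist hD0
  obtain ⟨Cd, hCd⟩ := hasGlobalMinimalModel_rat_holds (W.quadraticTwist (NumberField.discr K : ℚ))
  haveI : (Cd • W.quadraticTwist (NumberField.discr K : ℚ)).IsGloballyMinimal := hCd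
  have hdlo : MissingLowerBoundAt (Cd • W.quadraticTwist (NumberField.discr K : ℚ)) p :=
    hTwLo (W.conductorNorm ℤ) K (Cd • W.quadraticTwist (NumberField.discr K : ℚ)) rfl hK hHN hodd hd4 hB ⟨Cd, rfl⟩ hLt
  have hdup : MissingUpperBoundAt (Cd • W.quadraticTwist (NumberField.discr K : ℚ)) p :=
    hTwUp (W.conductorNorm ℤ) K (Cd • W.quadraticTwist (NumberField.discr K : ℚ)) rfl hK hHN hodd hd4 hB ⟨Cd, rfl⟩ hLt
  exact SchneiderFree.Exact.bsdp_of_exactIndexManin_of_partner_halves hGZ hKo hGZK hmod hGZ73 W p (W.conductorNorm ℤ) K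
    Dt H ι P (Cd • W.quadraticTwist (NumberField.discr K : ℚ)) hr rfl hpN hK hodd hwK hHN hLt hP ⟨Cd, rfl⟩ hp2 hlo hupI
    hdlo hdup


/-! ## §2 Potentially supersingular rows with no `K`-rational `p`-torsion over imaginary quadratic fields of large discriminant -/

section PotSSLargeDiscr

variable (p : ℕ) [Fact p.Prime] (R : WeierstrassCurve ℚ → Prop)

/-- **`BSD_p` in analytic rank one at EVERY odd additive potentially SUPERSINGULAR prime on the rows with `E(K)[p] = 0` for
all imaginary quadratic `K` of large discriminant — X4 rows (bound `0`) and the X3 rows whose `K`-rational `p`-torsion is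
confined to finitely many quadratic fields — local step DISCHARGED.** Rows `R W`, `ClassO5 W p ∨ ClassO6 W p`, `r_an = 1`, `hB`:
`∃ B, ∀ K imaginary quadratic, B < |d_K| → ∀ x ∈ E(K), p•x = 0 → x = 0`. Then `BSD_p(W)` ⟸ `hEq` (♭-IMC equality on the rows)
∧ `hTwLo`, `hTwUp` (the r = 0 LOWER and UPPER halves of globally minimal models of the rank-zero twists of rows, asked at Heegner
fields with `d_K` odd, `< −4`, `|d_K| > B`) ∧ Hsieh ∧ LZZ ∧ ToricPublishedInputs ∧ {Poitou–Tate ×2, local Euler–Poincaré,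
cd ≤ 2, Brink Thm 2 / Cor 1, Serre 1967}. Control: `additiveControlOnTreeAt_potSS_of_facts_of_serre1967` with `E(K)[p] = 0`
from `hB` at the Friedberg–Hoffstein field of discriminant beyond `B`. CONDITIONAL; closes nothing; BSD_p for no curve.
[cite: FriedbergHoffstein1995, Thm. B] [cite: JetchevSkinnerWan2017, §7.4.1 and Thm. 3.3.1 (arXiv:1512.06894)]
[cite: Hsieh2014, Thm. A p. 712 (Doc. Math. 19)] [cite: LiuZhangZhang2018, Thm 1.5.1 and Thm 1.5.3 (Duke Math. J. 167 pp. 748–749)]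
[cite: Brink2007, Thm. 2 and Cor. 1] [cite: Serre1967GroupesPDivisibles, §5 Prop. 8] -/
theorem bsdp_potSS_of_noTorsionLargeDiscr_of_flatIMCEq_of_twistHalves_of_facts
    (hA : Hsieh2014.thmA_exists_isHsiehLFunction_unrPeriod_anyLevel)
    (hL : LiuZhangZhang2018.thm151_thm153_modularCurve_heegnerVector_additive)
    (hF : ToricPublishedInputs)
    (hPT : ∀ (K : Type) [Field K] [NumberField K], poitouTate_selmerStructure_duality K)
    (hPT2 : ∀ (K : Type) [Field K] [NumberField K], poitouTate_sha_tateDual K)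
    (hEP : ∀ (K : Type) [Field K] [NumberField K] (v : HeightOneSpectrum (𝓞 K)),
      localEulerPoincareCharacteristic (v.adicCompletion K))
    (hcd : fieldCdLE_two_of_numberField)
    (hBr : ∀ (K : Type) [Field K] [NumberField K] (p : ℕ) [Fact p.Prime],
      ZpExtension.decomp_not_le_kerSubgroup_of_isAnticyclotomic K p)
    (hBr2 : ∀ (K : Type) [Field K] [NumberField K] (p : ℕ) [Fact p.Prime],
      ZpExtension.decomp_not_le_kerSubgroup_above_of_isAnticyclotomic K p)
    (hS : Serre1967.noStableDivisibleLine_of_potentiallySupersingular)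
    (hB : ∀ (W : WeierstrassCurve ℚ) [W.IsElliptic] [W.IsGloballyMinimal], R W → (ClassO5 W p ∨ ClassO6 W p) →
      W.analyticRank = 1 → ∃ B : ℕ, ∀ (K : Type) [Field K] [NumberField K], IsImaginaryQuadratic K →
        B < (NumberField.discr K).natAbs → ∀ x : (W.baseChange K).toAffine.Point, p • x = 0 → x = 0)
    (hEq : ∀ (W : WeierstrassCurve ℚ) [W.IsElliptic] [W.IsGloballyMinimal] (N : ℕ) [NeZero N] (K : Type) [Field K]
      [NumberField K] (Dt : ModularParametrizationData W N),
      R W → (ClassO5 W p ∨ ClassO6 W p) → W.analyticRank = 1 → W.conductorNorm ℤ = N →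
      IsImaginaryQuadratic K → SatisfiesHeegnerHypothesis N K →
      ∀ (κ : ZpExtension K p), κ.IsAnticyclotomic → ∀ (γ : Field.absoluteGaloisGroup K) [Fact (κ.IsTopGenerator γ)]
        (𝔭 : HeightOneSpectrum (𝓞 K)), ((p : ℕ) : 𝓞 K) ∈ 𝔭.asIdeal → 𝔭.asIdeal.ramificationIdx (𝓞 ℚ) = 1 →
        𝔭.asIdeal.inertiaDeg (𝓞 ℚ) = 1 → ∀ (𝔭' : HeightOneSpectrum (𝓞 K)), ((p : ℕ) : 𝓞 K) ∈ 𝔭'.asIdeal → 𝔭' ≠ 𝔭 →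
        ∀ (ι' : PadicAlgCl p ≃+* ℂ), SchneiderFree.BranchInducesPrime p ι' 𝔭 →
        ∀ (ΩK : ℂ) (Ωp : ℂ_[p]) (Q : PowerSeries (PadicComplexInt p)), ΩK ≠ 0 → Ωp ≠ 0 →
          R1.IsBDPLFunctionInt p ι' 𝔭 κ γ Dt.f ΩK Ωp Q →
          (XAc.charIdeal (W.baseChange K) p κ 𝔭' ∅ γ).map (PowerSeries.map (R1.toCpInt p)) = Ideal.span {Q})
    (hTwLo : ∀ (W : WeierstrassCurve ℚ) [W.IsElliptic] [W.IsGloballyMinimal] (N : ℕ) [NeZero N] (K : Type) [Field K]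
      [NumberField K] (Wd : WeierstrassCurve ℚ) [Wd.IsElliptic] [Wd.IsGloballyMinimal],
      R W → (ClassO5 W p ∨ ClassO6 W p) → W.analyticRank = 1 → W.conductorNorm ℤ = N →
      IsImaginaryQuadratic K → SatisfiesHeegnerHypothesis N K → Odd (NumberField.discr K) → NumberField.discr K < -4 →
      (∃ C : VariableChange ℚ, C • W.quadraticTwist (NumberField.discr K : ℚ) = Wd) →
      (W.quadraticTwist (NumberField.discr K : ℚ)).entireLFunction 1 ≠ 0 → MissingLowerBoundAt Wd p)
    (hTwUp : ∀ (W : WeierstrassCurve ℚ) [W.IsElliptic] [W.IsGloballyMinimal] (N : ℕ) [NeZero N] (K : Type) [Field K]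
      [NumberField K] (Wd : WeierstrassCurve ℚ) [Wd.IsElliptic] [Wd.IsGloballyMinimal],
      R W → (ClassO5 W p ∨ ClassO6 W p) → W.analyticRank = 1 → W.conductorNorm ℤ = N →
      IsImaginaryQuadratic K → SatisfiesHeegnerHypothesis N K → Odd (NumberField.discr K) → NumberField.discr K < -4 →
      (∃ C : VariableChange ℚ, C • W.quadraticTwist (NumberField.discr K : ℚ) = Wd) →
      (W.quadraticTwist (NumberField.discr K : ℚ)).entireLFunction 1 ≠ 0 → MissingUpperBoundAt Wd p) :
    ∀ (W : WeierstrassCurve ℚ) [W.IsElliptic] [W.IsGloballyMinimal],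
      R W → (ClassO5 W p ∨ ClassO6 W p) → W.analyticRank = 1 → BSDp W p := by
  intro W _ _ hR hcls hr
  have hp2 : p ≠ 2 := hcls.elim (fun h ↦ h.1) (fun h ↦ h.1)
  have haddv : Addv W p := hcls.elim (fun h ↦ h.2.1) (fun h ↦ h.2.1)
  have hj : 0 ≤ padicValRat p W.j := hcls.elim (fun h ↦ h.padicValRat_j_nonneg) (fun h ↦ h.padicValRat_j_nonneg)
  have hss : ∀ (F : Type) [Field F] [NumberField F] (w : HeightOneSpectrum (𝓞 F)),
      ((p : ℕ) : 𝓞 F) ∈ w.asIdeal → (W.baseChange F).HasGoodReductionAt w → ¬ (W.baseChange F).HasUnitRootAt w := by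
    intro F _ _ w hw hgood
    rcases hcls with h5 | h6
    · exact not_hasUnitRootAt_baseChange_of_classO5 W p h5 hw hgood
    · have h3 : p = 3 := h6.p_eq_three
      subst h3
      exact not_hasUnitRootAt_baseChange_of_not_typeG_three W h6.2.1 h6.not_typeG_three.1 hw hgood
  obtain ⟨B, hBK⟩ := hB W hR hcls hr
  have hKo : ∀ (N : ℕ) [NeZero N] (W : WeierstrassCurve ℚ) (K : Type) [Field K] [NumberField K],
      Literature.NumberTheory.EllipticCurves.kolyvagin N W K := hF.2.1
  refine bsdp_of_indexHalves_of_twistHalves_row_discr p hp2 hF B W haddv hr ?_ ?_ ?_ ?_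
  · intro N _ K _ _ Dt H ι P hN hK hHN _hodd hd4 hBd _hLt hP hnt
    refine indexLowerBoundLeAt_of_flatInclLe_of_control hp2 hA hL Dt H ι P haddv hN hK hHN hd4 hP hnt (hKo N W K)
      (fun κ hκ γ _ 𝔭 h𝔭 he hf 𝔭' h𝔭' hne ι' hind ΩK Ωp Q hΩK hΩp hBDP ↦
        (hEq W N K Dt hR hcls hr hN hK hHN κ hκ γ 𝔭 h𝔭 he hf 𝔭' h𝔭' hne ι' hind ΩK Ωp Q hΩK hΩp hBDP).le) ?_
    intro κ hκ γ _ 𝔭 h𝔭 he hf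
    have hpN : p ∣ W.conductorNorm ℤ :=
      (W.dvd_conductorNorm_iff_not_hasGoodReductionAtPrime p).mpr (not_good_of_addv W p haddv)
    have hsplit : SplitsIn K p := SchneiderFreeAdditiveX3.splitsIn_of_satisfiesHeegnerHypothesis hN hHN hpN
    obtain ⟨hrank, hSha⟩ := hKo N W K hK hHN ⟨Dt, H, ι, hP⟩ hnt
    exact additiveControlOnTreeAt_potSS_of_facts_of_serre1967 hPT hPT2 hEP hcd hBr hBr2 hS W p hp2 haddv hj hss K hK
      hsplit (hBK K hK hBd) κ hκ γ 𝔭 h𝔭 he hf hrank hSha P hnt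
  · intro N _ K _ _ Dt H ι P hN hK hHN _hodd hd4 hBd _hLt hP hnt
    refine indexUpperBoundLeAt_of_flatInclGe_of_control hp2 hA hL Dt H ι P haddv hN hK hHN hd4 hP hnt (hKo N W K)
      (fun κ hκ γ _ 𝔭 h𝔭 he hf 𝔭' h𝔭' hne ι' hind ΩK Ωp Q hΩK hΩp hBDP ↦
        (hEq W N K Dt hR hcls hr hN hK hHN κ hκ γ 𝔭 h𝔭 he hf 𝔭' h𝔭' hne ι' hind ΩK Ωp Q hΩK hΩp hBDP).ge) ?_
    intro κ hκ γ _ 𝔭 h𝔭 he hf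
    have hpN : p ∣ W.conductorNorm ℤ :=
      (W.dvd_conductorNorm_iff_not_hasGoodReductionAtPrime p).mpr (not_good_of_addv W p haddv)
    have hsplit : SplitsIn K p := SchneiderFreeAdditiveX3.splitsIn_of_satisfiesHeegnerHypothesis hN hHN hpN
    obtain ⟨hrank, hSha⟩ := hKo N W K hK hHN ⟨Dt, H, ι, hP⟩ hnt
    exact additiveControlOnTreeAt_potSS_of_facts_of_serre1967 hPT hPT2 hEP hcd hBr hBr2 hS W p hp2 haddv hj hss K hK
      hsplit (hBK K hK hBd) κ hκ γ 𝔭 h𝔭 he hf hrank hSha P hnt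
  · intro N _ K _ _ Wd _ _ hN hK hHN hodd hd4 _hBd hC hLt
    exact hTwLo W N K Wd hR hcls hr hN hK hHN hodd hd4 hC hLt
  · intro N _ K _ _ Wd _ _ hN hK hHN hodd hd4 _hBd hC hLt
    exact hTwUp W N K Wd hR hcls hr hN hK hHN hodd hd4 hC hLt

/-- **The r = 1 LOWER half on the same rows from the Eisenstein ♭-inclusion and the twists' r = 0 UPPER half, local step
DISCHARGED** (rows `R W`, `ClassO5 ∨ ClassO6`, `r_an = 1`, `hB` = no `K`-rational `p`-torsion over imaginary quadratic fields of
large discriminant). `MissingLowerBoundAt W p` ⟸ `hIncl` (X♭ on the rows) ∧ `hTwUp` (U₀ of the twists; for X3 at the wild `3`: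
K9's U₀-red 19190, settled by citation) ∧ Hsieh ∧ LZZ ∧ ToricPublishedInputs ∧ the seven facts. CONDITIONAL; closes nothing.
[cite: FriedbergHoffstein1995, Thm. B] [cite: JetchevSkinnerWan2017, §7.4.1 and Thm. 3.3.1 (arXiv:1512.06894)]
[cite: LiuZhangZhang2018, Thm 1.5.1 and Thm 1.5.3 (Duke Math. J. 167 pp. 748–749)] [cite: Serre1967GroupesPDivisibles, §5 Prop. 8] -/
theorem missingLowerBoundAt_potSS_of_noTorsionLargeDiscr_of_flatEisenstein_of_twistUpper_of_facts
    (hA : Hsieh2014.thmA_exists_isHsiehLFunction_unrPeriod_anyLevel)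
    (hL : LiuZhangZhang2018.thm151_thm153_modularCurve_heegnerVector_additive)
    (hF : ToricPublishedInputs)
    (hPT : ∀ (K : Type) [Field K] [NumberField K], poitouTate_selmerStructure_duality K)
    (hPT2 : ∀ (K : Type) [Field K] [NumberField K], poitouTate_sha_tateDual K)
    (hEP : ∀ (K : Type) [Field K] [NumberField K] (v : HeightOneSpectrum (𝓞 K)),
      localEulerPoincareCharacteristic (v.adicCompletion K))
    (hcd : fieldCdLE_two_of_numberField)
    (hBr : ∀ (K : Type) [Field K] [NumberField K] (p : ℕ) [Fact p.Prime],
      ZpExtension.decomp_not_le_kerSubgroup_of_isAnticyclotomic K p)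
    (hBr2 : ∀ (K : Type) [Field K] [NumberField K] (p : ℕ) [Fact p.Prime],
      ZpExtension.decomp_not_le_kerSubgroup_above_of_isAnticyclotomic K p)
    (hS : Serre1967.noStableDivisibleLine_of_potentiallySupersingular)
    (hB : ∀ (W : WeierstrassCurve ℚ) [W.IsElliptic] [W.IsGloballyMinimal], R W → (ClassO5 W p ∨ ClassO6 W p) →
      W.analyticRank = 1 → ∃ B : ℕ, ∀ (K : Type) [Field K] [NumberField K], IsImaginaryQuadratic K →
        B < (NumberField.discr K).natAbs → ∀ x : (W.baseChange K).toAffine.Point, p • x = 0 → x = 0)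
    (hIncl : ∀ (W : WeierstrassCurve ℚ) [W.IsElliptic] [W.IsGloballyMinimal] (N : ℕ) [NeZero N] (K : Type) [Field K]
      [NumberField K] (Dt : ModularParametrizationData W N),
      R W → (ClassO5 W p ∨ ClassO6 W p) → W.analyticRank = 1 → W.conductorNorm ℤ = N →
      IsImaginaryQuadratic K → SatisfiesHeegnerHypothesis N K →
      ∀ (κ : ZpExtension K p), κ.IsAnticyclotomic → ∀ (γ : Field.absoluteGaloisGroup K) [Fact (κ.IsTopGenerator γ)]
        (𝔭 : HeightOneSpectrum (𝓞 K)), ((p : ℕ) : 𝓞 K) ∈ 𝔭.asIdeal → 𝔭.asIdeal.ramificationIdx (𝓞 ℚ) = 1 →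
        𝔭.asIdeal.inertiaDeg (𝓞 ℚ) = 1 → ∀ (𝔭' : HeightOneSpectrum (𝓞 K)), ((p : ℕ) : 𝓞 K) ∈ 𝔭'.asIdeal → 𝔭' ≠ 𝔭 →
        ∀ (ι' : PadicAlgCl p ≃+* ℂ), SchneiderFree.BranchInducesPrime p ι' 𝔭 →
        ∀ (ΩK : ℂ) (Ωp : ℂ_[p]) (Q : PowerSeries (PadicComplexInt p)), ΩK ≠ 0 → Ωp ≠ 0 →
          R1.IsBDPLFunctionInt p ι' 𝔭 κ γ Dt.f ΩK Ωp Q →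
          (XAc.charIdeal (W.baseChange K) p κ 𝔭' ∅ γ).map (PowerSeries.map (R1.toCpInt p)) ≤ Ideal.span {Q})
    (hTwUp : ∀ (W : WeierstrassCurve ℚ) [W.IsElliptic] [W.IsGloballyMinimal] (N : ℕ) [NeZero N] (K : Type) [Field K]
      [NumberField K] (Wd : WeierstrassCurve ℚ) [Wd.IsElliptic] [Wd.IsGloballyMinimal],
      R W → (ClassO5 W p ∨ ClassO6 W p) → W.analyticRank = 1 → W.conductorNorm ℤ = N →
      IsImaginaryQuadratic K → SatisfiesHeegnerHypothesis N K → Odd (NumberField.discr K) → NumberField.discr K < -4 →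
      (∃ C : VariableChange ℚ, C • W.quadraticTwist (NumberField.discr K : ℚ) = Wd) →
      (W.quadraticTwist (NumberField.discr K : ℚ)).entireLFunction 1 ≠ 0 → MissingUpperBoundAt Wd p) :
    ∀ (W : WeierstrassCurve ℚ) [W.IsElliptic] [W.IsGloballyMinimal],
      R W → (ClassO5 W p ∨ ClassO6 W p) → W.analyticRank = 1 → MissingLowerBoundAt W p := by
  intro W _ _ hR hcls hr
  have hp2 : p ≠ 2 := hcls.elim (fun h ↦ h.1) (fun h ↦ h.1)
  have haddv : Addv W p := hcls.elim (fun h ↦ h.2.1) (fun h ↦ h.2.1)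
  have hj : 0 ≤ padicValRat p W.j := hcls.elim (fun h ↦ h.padicValRat_j_nonneg) (fun h ↦ h.padicValRat_j_nonneg)
  have hss : ∀ (F : Type) [Field F] [NumberField F] (w : HeightOneSpectrum (𝓞 F)),
      ((p : ℕ) : 𝓞 F) ∈ w.asIdeal → (W.baseChange F).HasGoodReductionAt w → ¬ (W.baseChange F).HasUnitRootAt w := by
    intro F _ _ w hw hgood
    rcases hcls with h5 | h6
    · exact not_hasUnitRootAt_baseChange_of_classO5 W p h5 hw hgood
    · have h3 : p = 3 := h6.p_eq_three
      subst h3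
      exact not_hasUnitRootAt_baseChange_of_not_typeG_three W h6.2.1 h6.not_typeG_three.1 hw hgood
  obtain ⟨B, hBK⟩ := hB W hR hcls hr
  have hKo : ∀ (N : ℕ) [NeZero N] (W : WeierstrassCurve ℚ) (K : Type) [Field K] [NumberField K],
      Literature.NumberTheory.EllipticCurves.kolyvagin N W K := hF.2.1
  refine missingLowerBoundAt_of_indexLower_of_twistUpper_row_discr p hp2 hF B W haddv hr ?_ ?_
  · intro N _ K _ _ Dt H ι P hN hK hHN _hodd hd4 hBd _hLt hP hnt
    refine indexLowerBoundLeAt_of_flatInclLe_of_control hp2 hA hL Dt H ι P haddv hN hK hHN hd4 hP hnt (hKo N W K)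
      (fun κ hκ γ _ 𝔭 h𝔭 he hf 𝔭' h𝔭' hne ι' hind ΩK Ωp Q hΩK hΩp hBDP ↦
        hIncl W N K Dt hR hcls hr hN hK hHN κ hκ γ 𝔭 h𝔭 he hf 𝔭' h𝔭' hne ι' hind ΩK Ωp Q hΩK hΩp hBDP) ?_
    intro κ hκ γ _ 𝔭 h𝔭 he hf
    have hpN : p ∣ W.conductorNorm ℤ :=
      (W.dvd_conductorNorm_iff_not_hasGoodReductionAtPrime p).mpr (not_good_of_addv W p haddv)
    have hsplit : SplitsIn K p := SchneiderFreeAdditiveX3.splitsIn_of_satisfiesHeegnerHypothesis hN hHN hpN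
    obtain ⟨hrank, hSha⟩ := hKo N W K hK hHN ⟨Dt, H, ι, hP⟩ hnt
    exact additiveControlOnTreeAt_potSS_of_facts_of_serre1967 hPT hPT2 hEP hcd hBr hBr2 hS W p hp2 haddv hj hss K hK
      hsplit (hBK K hK hBd) κ hκ γ 𝔭 h𝔭 he hf hrank hSha P hnt
  · intro N _ K _ _ Wd _ _ hN hK hHN hodd hd4 _hBd hC hLt
    exact hTwUp W N K Wd hR hcls hr hN hK hHN hodd hd4 hC hLt

end PotSSLargeDiscr

end Summit.BirchSwinnertonDyer.BirchSwinnertonDyer.Theorems.UniversalToricDescentWaldspurgerFlat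

end
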